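import Summits.Schanuel.Schanuel.Theorems.ZilberEacCriticalEqualFibreExistence
import Summits.Schanuel.Schanuel.Theorems.ZilberEacCriticalPowerFibreDensity
import HarnessLib

/-!
# The critical size with an EQUAL general fibre polynomial: Zariski density
# `{x₂ = r₀x₀ + (1/e - r₀)x₁ + c, yⱼ = xⱼ + y₂F(y₂)}`, `e = 1 + deg F`, `r₀ ∉ ℚ`, `c ∈ ℂ`

Zilber's Exponential-Algebraic Closedness, case ladder (host summit Schanuel, cell `pub-schanuel`,
seat 2, gen 13).  THE FAMILY (`F ∈ ℂ[u] ∖ 0`, `e = deg F + 1`, `r₀ ∈ ℝ ∖ ℚ`, `c ∈ ℂ`):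

  `W = {x₂ = r₀x₀ + (1/e - r₀)x₁ + c,  y₀ = x₀ + y₂F(y₂),  y₁ = x₁ + y₂F(y₂)} ⊆ ℂ³ × ℂ³`

— the critical size `λ(1 + deg F) = 1` with an ARBITRARY fibre polynomial, equal for the two
fibres (O55 (a) / O56 (a), first clause).  Existence: `ZilberEacCriticalEqualFibreExistence`
(small parameter `σ = m^{-1/e}` carries the lower-order terms of `F`); elimination: THEOREM N₂ in the
coordinates `(x₀, x₁, y₀)` with the translated rotating pairs `(2πik, E_k)`,
`E_k = 2πie/(1 - lc(F)e^{ec}u_k)`, `u_k = e^{2πi(1 - er₀)k}`.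

**THEOREM (`unprojectedDense_polyFibredGraph_critical_equalFibre`).**  `I(W ∩ Γ_exp) = I(W)`.
Example **`sqrtTwoHalfSqLin_member_dense`**: `{x₂ = √2x₀ + (1/2 - √2)x₁, yⱼ = xⱼ + y₂² + y₂}`
(`F = u + 1`) ∈ EC(3,2), DENSE.

HONEST FRAMING: explicit families inside an OPEN cell (UNEQUAL fibres `F₀ ≠ F₁` at critical size
stay open); `EC(3,2)` OPEN; NOT Schanuel's conjecture; EAC ⇏ SC.
-/

noncomputable section

open Complex MvPolynomial Filter Topology
open Literature.NumberTheory.Transcendental Literature.ModelTheory.Zilber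
  Literature.ModelTheory.ExponentialFields

set_option linter.dupNamespace false

namespace Summit.Schanuel.Schanuel.Theorems

section EqualFibreDensity

/-- **THEOREM (Zariski density at critical size, equal general fibre polynomial).**  See the module
docstring. (new) [cite: MantovaMasser2023, §1 p.5 (the open case dim π(V) = 2 in ℂ³×ℂˣ³)] -/
theorem unprojectedDense_polyFibredGraph_critical_equalFibre (F : Polynomial ℂ) (hF : F ≠ 0)
    (r₀ : ℝ) (hr : Irrational r₀) (c : ℂ) :
    UnprojectedDense (polyFibredGraph
      (hyperplanePoly ![r₀, 1 / ((F.natDegree + 1 : ℕ) : ℝ) - r₀] c) (fun j => X j)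
      (fun _ => F.toMvPolynomial 0)) := by
  classical
  have hπ := Real.pi_pos
  have h2πI : (2 * Real.pi * I : ℂ) ≠ 0 := Complex.two_pi_I_ne_zero
  set e : ℕ := F.natDegree + 1 with hedef
  have he : 1 ≤ e := by omega
  have he0 : e ≠ 0 := by omega
  have heC : (e : ℂ) ≠ 0 := by exact_mod_cast he0
  have heZ : ((e : ℤ)) ≠ 0 := by exact_mod_cast he0
  set lc : ℂ := F.coeff (e - 1) with hlc
  have hlc0 : lc ≠ 0 := by
    rw [hlc, hedef, Nat.add_sub_cancel, Polynomial.coeff_natDegree]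
    exact Polynomial.leadingCoeff_ne_zero.2 hF
  -- `exp c' = lc · e^{ec}`
  set c' : ℂ := (e : ℂ) * c + log lc with hc'
  have hexpc' : exp c' = lc * exp ((e : ℂ) * c) := by
    rw [hc', Complex.exp_add, Complex.exp_log hlc0]; ring
  set r₀' : ℝ := (e : ℝ) * r₀ with hr₀'
  have hr1' : Irrational (1 - r₀') := by
    rw [hr₀']
    have : Irrational ((e : ℝ) * r₀) := by simpa using hr.natCast_mul he0
    simpa using this.ratCast_sub 1
  -- rotating numbers, limit values, generic pairs
  set u : ℕ → ℂ := fun k => exp (2 * Real.pi * I * ((1 - r₀' : ℝ) : ℂ) * (k : ℂ)) with hu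
  set Ev : ℕ → ℂ := fun k => 2 * Real.pi * I * ((e : ℤ) : ℂ) +
    2 * Real.pi * I * ((e : ℤ) : ℂ) * (exp c' * u k) / (1 - exp c' * u k) with hEv
  set PS : Set (ℂ × ℂ) := {vt | ∃ k : ℕ, exp c' * u k ≠ 1 ∧
    vt = (2 * Real.pi * I * (k : ℂ), Ev k)} with hPS
  have hgen : ∀ Q : MvPolynomial (Fin 2) ℂ, Q ≠ 0 → ∃ vt ∈ PS, eval ![vt.1, vt.2] Q ≠ 0 := by
    intro Q hQ
    obtain ⟨k, hgood, hne⟩ := diagonalCritical_pairs_generic_translate hr1' c' (p := (e : ℤ)) heZ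
      (2 * Real.pi * I * ((e : ℤ) : ℂ)) Q hQ
    exact ⟨_, ⟨k, hgood, rfl⟩, hne⟩
  set r : Fin 2 → ℝ := ![r₀, 1 / (e : ℝ) - r₀] with hrdef
  refine unprojectedDense_of_bddLinLin (isIrreducibleClosed_polyFibredGraph _ _ _)
    (by rw [zariskiDim_polyFibredGraph]) ![Sum.inl 0, Sum.inl 1, Sum.inr 0]
    (Wst := 2 * Real.pi * I * (e : ℂ)) (mul_ne_zero h2πI heC) hgen ?_
  rintro _ ⟨k, hgood, rfl⟩
  -- base point
  have hden : (1 : ℂ) - exp c' * u k ≠ 0 := by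
    intro h; apply hgood; linear_combination -h
  set P : ℂ := 2 * Real.pi * I * (e : ℂ) * ((1 : ℤ) : ℂ) with hP
  set E : ℂ := P / (1 - exp c' * u k) with hE
  have hPne : P ≠ 0 := by rw [hP]; push_cast; rw [mul_one]; exact mul_ne_zero h2πI heC
  have hE0 : E ≠ 0 := div_ne_zero hPne hden
  have hEeq : E * (1 - exp c' * u k) = P := by rw [hE, div_mul_cancel₀ _ hden]
  set ρs : ℂ × ℂ := (log E, log E + 2 * Real.pi * I * (k : ℂ)) with hρs
  have heE : exp (log E) = E := Complex.exp_log hE0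
  have hek : exp (2 * Real.pi * I * (k : ℂ)) = 1 := by
    have := Complex.exp_int_mul_two_pi_mul_I (k : ℤ)
    rw [← this]; congr 1; push_cast; ring
  have hG : lc * exp ((e : ℂ) * (c + (r₀ : ℂ) * ρs.1 + ((1 / (e : ℝ) - r₀ : ℝ) : ℂ) * ρs.2)) =
      exp c' * E * u k := by
    simp only [hρs, hu, hexpc']
    rw [show (e : ℂ) * (c + (r₀ : ℂ) * log E + ((1 / (e : ℝ) - r₀ : ℝ) : ℂ) *
        (log E + 2 * Real.pi * I * (k : ℂ))) = (e : ℂ) * c + (log E +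
        2 * Real.pi * I * ((1 - r₀' : ℝ) : ℂ) * (k : ℂ)) by
      rw [hr₀']; push_cast; field_simp; ring]
    rw [Complex.exp_add, Complex.exp_add, heE]
    ring
  have h0 : exp ρs.1 = 2 * Real.pi * I * (e : ℂ) * ((1 : ℤ) : ℂ) +
      F.coeff (e - 1) * exp ((e : ℂ) * (c + (r₀ : ℂ) * ρs.1 +
        ((1 / (e : ℝ) - r₀ : ℝ) : ℂ) * ρs.2)) := by
    rw [← hlc, hG, ← hP]
    simp only [hρs, heE]
    linear_combination hEeq
  have h1 : exp ρs.2 = 2 * Real.pi * I * (e : ℂ) * ((1 : ℤ) : ℂ) +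
      F.coeff (e - 1) * exp ((e : ℂ) * (c + (r₀ : ℂ) * ρs.1 +
        ((1 / (e : ℝ) - r₀ : ℝ) : ℂ) * ρs.2)) := by
    rw [← hlc, hG, ← hP]
    simp only [hρs]
    rw [Complex.exp_add, heE, hek]
    linear_combination hEeq
  have hEvk : Ev k = E := by
    simp only [hEv, hE, hP]
    push_cast
    field_simp
    ring
  -- the solutions
  obtain ⟨x, ρ, hρ, hx0, hx1, hsol⟩ :=
    exists_solutions_criticalEqualFibre e he (fun i => F.coeff i) r₀ c (p := 1) one_ne_zero h0 h1
  set P3 : ℕ → Fin 3 ⊕ Fin 3 → ℂ := fun m =>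
    pgParam (hyperplanePoly r c) (fun j => X j) (fun _ => F.toMvPolynomial 0)
      (x m) (exp (∑ i, (r i : ℂ) * x m i + c)) with hP3
  have hρ1 : Tendsto (fun m => (ρ m).1) atTop (𝓝 ρs.1) := (continuous_fst.tendsto _).comp hρ
  have hρ2 : Tendsto (fun m => (ρ m).2) atTop (𝓝 ρs.2) := (continuous_snd.tendsto _).comp hρ
  have hs0 : Tendsto (fun m : ℕ => (((1 / (m : ℝ) : ℝ)) : ℂ)) atTop (𝓝 0) := by
    have h := (continuous_ofReal.tendsto (0 : ℝ)).comp tendsto_one_div_atTop_nhds_zero_nat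
    rw [ofReal_zero] at h
    exact h
  have hl0 : Tendsto (fun m : ℕ => (((Real.log m / (m : ℝ) : ℝ)) : ℂ)) atTop (𝓝 0) := by
    have h := (continuous_ofReal.tendsto (0 : ℝ)).comp
      (tendsto_log_pow_div_natCast_comp (d := fun m => m) tendsto_id 1)
    rw [ofReal_zero] at h
    refine h.congr fun m => ?_
    simp only [Function.comp_apply, pow_one]
  -- the solution property in the shape of `pgParam_hyperplane_mem_expGraph`
  have hsolW : ∀ᶠ m in atTop, ∀ j : Fin 2, exp (x m j) = eval (x m) (X j) +
      exp (∑ i, (r i : ℂ) * x m i + c) * F.eval (exp (∑ i, (r i : ℂ) * x m i + c)) := by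
    filter_upwards [hsol] with m hm j
    rw [eval_X, Polynomial.eval_eq_sum_range, hm j]
  refine ⟨P3, fun m => (m : ℝ), ?_, tendsto_natCast_atTop_atTop, ?_, ?_, ?_⟩
  · filter_upwards [hsolW] with m hm
    exact ⟨pgParam_mem _ _ _ _ _, pgParam_hyperplane_mem_expGraph r c (fun j => X j)
      (fun _ => F) hm⟩
  · -- `x₁ - x₀ → 2πik`
    have hlim : Tendsto (fun m => (ρ m).2 - (ρ m).1) atTop (𝓝 (ρs.2 - ρs.1)) := hρ2.sub hρ1
    have eρ : ρs.2 - ρs.1 = 2 * Real.pi * I * (k : ℂ) := by simp only [hρs]; ring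
    rw [eρ] at hlim
    refine hlim.congr fun m => ?_
    have e0 : (Sum.inl 0 : Fin 3 ⊕ Fin 3) = Sum.inl (Fin.castSucc (0 : Fin 2)) := rfl
    have e1 : (Sum.inl 1 : Fin 3 ⊕ Fin 3) = Sum.inl (Fin.castSucc (1 : Fin 2)) := rfl
    simp only [hP3, Matrix.cons_val_one, Matrix.cons_val_zero, e0, e1, pgParam_inl_castSucc,
      hx0 m, hx1 m]
    ring
  · -- `x₀ / m → 2πi e`
    have hlim : Tendsto (fun m : ℕ => 2 * Real.pi * I * (e : ℂ) +
        (((Real.log m / (m : ℝ) : ℝ)) : ℂ) + (ρ m).1 * (((1 / (m : ℝ) : ℝ)) : ℂ)) atTop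
        (𝓝 (2 * Real.pi * I * (e : ℂ) + 0 + ρs.1 * 0)) :=
      (tendsto_const_nhds.add hl0).add (hρ1.mul hs0)
    simp only [add_zero, mul_zero] at hlim
    refine hlim.congr' ?_
    filter_upwards [eventually_ge_atTop 1] with m hm
    have hmC : (m : ℂ) ≠ 0 := by exact_mod_cast (show m ≠ 0 by omega)
    have e0 : (Sum.inl 0 : Fin 3 ⊕ Fin 3) = Sum.inl (Fin.castSucc (0 : Fin 2)) := rfl
    simp only [hP3, Matrix.cons_val_zero, e0, pgParam_inl_castSucc, hx0 m]
    push_cast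
    field_simp
  · -- `y₀ / m = e^{x₀}/m = e^{ρ₀(m)} → E = Ev k`
    have hlim : Tendsto (fun m => exp (ρ m).1) atTop (𝓝 (exp ρs.1)) :=
      (Complex.continuous_exp.tendsto _).comp hρ1
    have eρ : exp ρs.1 = Ev k := by rw [hEvk]; simp only [hρs, heE]
    rw [eρ] at hlim
    refine hlim.congr' ?_
    filter_upwards [hsolW, eventually_ge_atTop 1] with m hm hm1
    have hmpos : (0 : ℝ) < (m : ℝ) := by exact_mod_cast hm1
    have hmC : (m : ℂ) ≠ 0 := by exact_mod_cast (show m ≠ 0 by omega)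
    have hexpL : exp ((Real.log m : ℝ) : ℂ) = (m : ℂ) := by
      rw [← Complex.ofReal_exp, Real.exp_log hmpos]
      push_cast
      rfl
    have hexpP : exp (2 * Real.pi * I * (e : ℂ) * ((1 : ℤ) : ℂ) * (m : ℂ)) = 1 := by
      have := Complex.exp_int_mul_two_pi_mul_I ((e : ℤ) * m)
      rw [← this]; congr 1; push_cast; ring
    have e0 : (Sum.inr 0 : Fin 3 ⊕ Fin 3) = Sum.inr (Fin.castSucc (0 : Fin 2)) := rfl
    have hcoord : P3 m (Sum.inr 0) = exp (x m 0) := by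
      simp only [hP3, e0, pgParam_inr, pMulParam_castSucc]
      rw [hm 0, MvPolynomial.eval_toMvPolynomial, Fin.cons_zero]
    rw [show (![Sum.inl 0, Sum.inl 1, Sum.inr 0] : Fin 3 → Fin 3 ⊕ Fin 3) 2 = Sum.inr 0 from rfl,
      hcoord, hx0 m, Complex.exp_add, Complex.exp_add, hexpP, one_mul, hexpL]
    push_cast
    field_simp

/-- **Certified members at critical size with an equal general fibre polynomial, dense.**  For
`F ≠ 0`, irrational `r₀`, every `c`: all seven hypotheses of `ECCell 3 2`, not linearly split,
`W ∩ Γ_exp ≠ ∅`, `I(W ∩ Γ_exp) = I(W)`. (new)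
[cite: MantovaMasser2023, §1 p.5 (the open case dim π(V) = 2 in ℂ³×ℂˣ³)] -/
theorem polyFibredGraph_critical_equalFibre_member_dense (F : Polynomial ℂ) (hF : F ≠ 0)
    (r₀ : ℝ) (hr : Irrational r₀) (c : ℂ) :
    (IsIrreducibleClosed ℂ (polyFibredGraph
        (hyperplanePoly ![r₀, 1 / ((F.natDegree + 1 : ℕ) : ℝ) - r₀] c) (fun j => X j)
        (fun _ => F.toMvPolynomial 0)) ∧
      (polyFibredGraph (hyperplanePoly ![r₀, 1 / ((F.natDegree + 1 : ℕ) : ℝ) - r₀] c)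
          (fun j => X j) (fun _ => F.toMvPolynomial 0) ∩ torusLocus ℂ 3).Nonempty ∧
      IsRotund ℂ 3 (polyFibredGraph (hyperplanePoly ![r₀, 1 / ((F.natDegree + 1 : ℕ) : ℝ) - r₀] c)
          (fun j => X j) (fun _ => F.toMvPolynomial 0) ∩ torusLocus ℂ 3) ∧
      IsAddFree ℂ 3 (polyFibredGraph (hyperplanePoly ![r₀, 1 / ((F.natDegree + 1 : ℕ) : ℝ) - r₀] c)
          (fun j => X j) (fun _ => F.toMvPolynomial 0) ∩ torusLocus ℂ 3) ∧
      IsMulFree ℂ 3 (polyFibredGraph (hyperplanePoly ![r₀, 1 / ((F.natDegree + 1 : ℕ) : ℝ) - r₀] c)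
          (fun j => X j) (fun _ => F.toMvPolynomial 0) ∩ torusLocus ℂ 3) ∧
      zariskiDim ℂ (polyFibredGraph (hyperplanePoly ![r₀, 1 / ((F.natDegree + 1 : ℕ) : ℝ) - r₀] c)
          (fun j => X j) (fun _ => F.toMvPolynomial 0)) = (3 : ℕ) ∧
      addProjDim ℂ 3 (polyFibredGraph (hyperplanePoly ![r₀, 1 / ((F.natDegree + 1 : ℕ) : ℝ) - r₀] c)
          (fun j => X j) (fun _ => F.toMvPolynomial 0)) = (2 : ℕ)) ∧
    ¬ IsLinearSplit ℂ 3 (polyFibredGraph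
        (hyperplanePoly ![r₀, 1 / ((F.natDegree + 1 : ℕ) : ℝ) - r₀] c) (fun j => X j)
        (fun _ => F.toMvPolynomial 0)) ∧
    (polyFibredGraph (hyperplanePoly ![r₀, 1 / ((F.natDegree + 1 : ℕ) : ℝ) - r₀] c)
        (fun j => X j) (fun _ => F.toMvPolynomial 0) ∩ expGraph ℂ 3).Nonempty ∧
    UnprojectedDense (polyFibredGraph
        (hyperplanePoly ![r₀, 1 / ((F.natDegree + 1 : ℕ) : ℝ) - r₀] c) (fun j => X j)
        (fun _ => F.toMvPolynomial 0)) := by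
  have hA : Function.Injective (aeval (fun j : Fin 2 => (X j : MvPolynomial (Fin 2) ℂ)) :
      MvPolynomial (Fin 2) ℂ →ₐ[ℂ] MvPolynomial (Fin 2) ℂ) := by
    rw [aeval_X_left]; exact fun _ _ h => h
  have hirr : ∃ i : Fin 2, Irrational
      ((![r₀, 1 / ((F.natDegree + 1 : ℕ) : ℝ) - r₀] : Fin 2 → ℝ) i) := ⟨0, by simpa using hr⟩
  have hcell := ecCell_hypotheses_polyFibredGraph_hyperplane
    ![r₀, 1 / ((F.natDegree + 1 : ℕ) : ℝ) - r₀] c (fun j => X j) (fun _ => F.toMvPolynomial 0)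
    hA hirr
  have hdense := unprojectedDense_polyFibredGraph_critical_equalFibre F hF r₀ hr c
  refine ⟨hcell, not_isLinearSplit_polyFibredGraph _ (fun j => X j) _ (by norm_num) hA, ?_,
    hdense⟩
  obtain ⟨w, hw, -⟩ := hcell.2.1
  exact inter_expGraph_nonempty_of_vanishingIdeal_eq ⟨w, hw⟩ hdense

/-- **A critical example with a fibre polynomial having a lower-order term is dense**:
`W = {x₂ = √2x₀ + (1/2 - √2)x₁, y₀ = x₀ + y₂² + y₂, y₁ = x₁ + y₂² + y₂}` (`F = u + 1`, `e = 2`):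
all seven hypotheses of `ECCell 3 2`, not linearly split, `W ∩ Γ_exp ≠ ∅`, `I(W ∩ Γ_exp) = I(W)`.
(new) [cite: MantovaMasser2023, §1 p.5 (the open case dim π(V) = 2 in ℂ³×ℂˣ³)] -/
theorem sqrtTwoHalfSqLin_member_dense :
    (IsIrreducibleClosed ℂ (polyFibredGraph
        (hyperplanePoly ![Real.sqrt 2, 1 / (((Polynomial.X + 1 : Polynomial ℂ).natDegree + 1 : ℕ) : ℝ) -
          Real.sqrt 2] 0) (fun j => X j) (fun _ => (Polynomial.X + 1 : Polynomial ℂ).toMvPolynomial 0)) ∧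
      (polyFibredGraph (hyperplanePoly ![Real.sqrt 2,
          1 / (((Polynomial.X + 1 : Polynomial ℂ).natDegree + 1 : ℕ) : ℝ) - Real.sqrt 2] 0)
          (fun j => X j) (fun _ => (Polynomial.X + 1 : Polynomial ℂ).toMvPolynomial 0) ∩
            torusLocus ℂ 3).Nonempty ∧
      IsRotund ℂ 3 (polyFibredGraph (hyperplanePoly ![Real.sqrt 2,
          1 / (((Polynomial.X + 1 : Polynomial ℂ).natDegree + 1 : ℕ) : ℝ) - Real.sqrt 2] 0)
          (fun j => X j) (fun _ => (Polynomial.X + 1 : Polynomial ℂ).toMvPolynomial 0) ∩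
            torusLocus ℂ 3) ∧
      IsAddFree ℂ 3 (polyFibredGraph (hyperplanePoly ![Real.sqrt 2,
          1 / (((Polynomial.X + 1 : Polynomial ℂ).natDegree + 1 : ℕ) : ℝ) - Real.sqrt 2] 0)
          (fun j => X j) (fun _ => (Polynomial.X + 1 : Polynomial ℂ).toMvPolynomial 0) ∩
            torusLocus ℂ 3) ∧
      IsMulFree ℂ 3 (polyFibredGraph (hyperplanePoly ![Real.sqrt 2,
          1 / (((Polynomial.X + 1 : Polynomial ℂ).natDegree + 1 : ℕ) : ℝ) - Real.sqrt 2] 0)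
          (fun j => X j) (fun _ => (Polynomial.X + 1 : Polynomial ℂ).toMvPolynomial 0) ∩
            torusLocus ℂ 3) ∧
      zariskiDim ℂ (polyFibredGraph (hyperplanePoly ![Real.sqrt 2,
          1 / (((Polynomial.X + 1 : Polynomial ℂ).natDegree + 1 : ℕ) : ℝ) - Real.sqrt 2] 0)
          (fun j => X j) (fun _ => (Polynomial.X + 1 : Polynomial ℂ).toMvPolynomial 0)) = (3 : ℕ) ∧
      addProjDim ℂ 3 (polyFibredGraph (hyperplanePoly ![Real.sqrt 2,
          1 / (((Polynomial.X + 1 : Polynomial ℂ).natDegree + 1 : ℕ) : ℝ) - Real.sqrt 2] 0)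
          (fun j => X j) (fun _ => (Polynomial.X + 1 : Polynomial ℂ).toMvPolynomial 0)) = (2 : ℕ)) ∧
    ¬ IsLinearSplit ℂ 3 (polyFibredGraph (hyperplanePoly ![Real.sqrt 2,
          1 / (((Polynomial.X + 1 : Polynomial ℂ).natDegree + 1 : ℕ) : ℝ) - Real.sqrt 2] 0)
        (fun j => X j) (fun _ => (Polynomial.X + 1 : Polynomial ℂ).toMvPolynomial 0)) ∧
    (polyFibredGraph (hyperplanePoly ![Real.sqrt 2,
          1 / (((Polynomial.X + 1 : Polynomial ℂ).natDegree + 1 : ℕ) : ℝ) - Real.sqrt 2] 0)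
        (fun j => X j) (fun _ => (Polynomial.X + 1 : Polynomial ℂ).toMvPolynomial 0) ∩
          expGraph ℂ 3).Nonempty ∧
    UnprojectedDense (polyFibredGraph (hyperplanePoly ![Real.sqrt 2,
          1 / (((Polynomial.X + 1 : Polynomial ℂ).natDegree + 1 : ℕ) : ℝ) - Real.sqrt 2] 0)
        (fun j => X j) (fun _ => (Polynomial.X + 1 : Polynomial ℂ).toMvPolynomial 0)) :=
  polyFibredGraph_critical_equalFibre_member_dense (Polynomial.X + 1)
    (Polynomial.X_add_C_ne_zero 1) (Real.sqrt 2) irrational_sqrt_two 0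

end EqualFibreDensity

end Summit.Schanuel.Schanuel.Theorems

end
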